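import Mathlib.RingTheory.Localization.Away.Basic
import Summits.Ventures.HSemireg.EmbeddedFirstOrderDeformationsCocycle
import Summits.Ventures.HSemireg.EmbeddedFirstOrderDeformationsTorsorLocalization

/-!
# Venture HSemireg — GLUING flat lifts along a finite Zariski cover: flat lifts of `I` to a flat first-order
# thickening `π : R' ↠ R` ⟷ compatible families of flat lifts on the opens `Spec R'_{f_α}`, `(f_α) = R'`
# (the sheaf property behind the Čech sentence of PROPOSITION K)

HONEST FRAMING.  Lean side of the computation cell `pub-hsemireg` (track «S4-PUSH» (ii), seat s4-prove-3 g3, second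
route for (S5)); log `s4push/prove-3/ATTEMPT-7.md` (Part B).  Plain commutative algebra: a flat first-order thickening
`π : R' ↠ R` with parameter `e` (`IsFirstOrderThickening`), finitely many `f_α ∈ R'` generating the unit ideal, and for
each `α` localisations `A α` of `R'` away from `f_α` and `B α` of `R` away from `π f_α`; no scheme, sheaf, Čech complex,
abelian variety or semiregularity map is constructed; nothing here says that HC, HC_CM or HC_AV holds; no object is
certified; no Literature fact is declared.

WHY.  PROPOSITION K (the (H-arr) input of the (S5) files; cell text G2-REDUCIBLE-POINT-THEOREM §3): «`Z` extends flatly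
along `A_ξ` ⟺ the Čech cocycle `(π(θ_αβ))` is a coboundary in `H¹(Z, N)`».  Its (⇐) half GLUES compatible local flat
lifts into a global one.  `…Torsor` gives the pseudotorsor of lifts (Hartshorne Thm. 6.2 (a)), `…Cocycle` the twist
formula, `…TorsorLocalization` the restriction of thickenings and lifts to the opens `Spec R'_T`.  THIS FILE proves the
gluing: with `glued A J := ⋂_α (R' → A α)⁻¹(J α)`,
* `map_glued_eq` — if the local ideals are COMPATIBLE (`x/1 ∈ J α ⇒ f_α^m x / 1 ∈ J β` for some `m`, i.e.
  `J α|_{αβ} ⊆ J β|_{αβ}`), then `(glued A J)·A α = J α` for every `α`;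
* `eq_glued_of_forall_map_eq` — the glued ideal is the ONLY ideal of `R'` restricting to the `J α` (membership in an
  ideal is local on the cover: Mathlib `Submodule.mem_of_span_eq_top_of_smul_pow_mem`); `compatible_map` — restricted
  families `(K·A α)` are compatible;
* **`isLift_glued`** — if every `J α` is a flat lift of `I·B α` to the localised thickening `πₐ : A α ↠ B α`
  (`locMap`, parameter `e/1`), then `glued A J` is a flat lift of `I` to `π`: `π(J) ⊆ I` (locality of membership in `I`
  on the cover `(π f_α) = R`), `J ↠ I` and the flatness condition `e z ∈ J ⇒ z ∈ J + eR'` (both are membership in the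
  ideal `J + eR'`, which holds locally by surjectivity `J α ↠ I·B α` / flatness of `J α` and the kernel `(e/1)` of `πₐ`,
  and globalises by `mem_glued_sup_span_of_forall`).
* **`liftEquivCompatibleFamily`** — the same packaged as a bijection
  `{flat lifts of I to π} ≃ {compatible families of flat lifts on the cover}`;
* **`exists_isLift_iff_exists_compatible_translate`** — for a LOCALLY SPLIT thickening (sections `σ_α` of `πₐ`): a
  global flat lift exists iff some translates of the local trivial lifts form a compatible family (Prop. K's sentence
  in torsor form; the Čech-notation rewriting on overlaps is not typed here).
So: flat lifts of `I` to `π` correspond to compatible families of flat lifts on a finite affine cover — the sheaf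
property that, combined with the pseudotorsor structure (`IsLift.diff`, `translate`) and the twist formula, is the
content of Prop. K's Čech sentence for literal ideal sheaves on an affine `A` with `A_ξ` given by a derivation cocycle.

NOT covered: the identification `(θ_αβ) ↔ ξ ∈ H¹(A, T_A)`; `A` smooth ⇒ local triviality of `A_ξ`; the
branch-following criterion of (H-arr).

References: R. Hartshorne, *Deformation Theory*, GTM 257 (2010), §2 Thm. 2.4, §6 Thm. 6.2 [corpus:
book:springernd-deformation-theory p0015–p0016, p0047]; Mathlib `Submodule.mem_of_span_eq_top_of_smul_pow_mem`,
`IsLocalization.Away`.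
-/

namespace Summit.Ventures.HSemireg

namespace EmbeddedDeformation

universe u v w u' v'

section Glue

variable {R' : Type u} [CommRing R'] {ι : Type w} (f : ι → R')
variable (A : ι → Type u') [∀ α, CommRing (A α)] [∀ α, Algebra R' (A α)]

/-- **The glued ideal** of a family of local ideals `J α ⊆ A α` on a cover: `⋂_α (R' → A α)⁻¹(J α)`. [folklore] -/
def glued (J : ∀ α, Ideal (A α)) : Ideal R' := ⨅ α, (J α).comap (algebraMap R' (A α))

variable {A}

/-- `x ∈ glued A J ⟺ x/1 ∈ J α` for every `α`. [folklore] -/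
theorem mem_glued_iff {J : ∀ α, Ideal (A α)} {x : R'} : x ∈ glued A J ↔ ∀ α, algebraMap R' (A α) x ∈ J α := by
  simp only [glued, Ideal.mem_iInf, Ideal.mem_comap]

variable [∀ α, IsLocalization.Away (f α) (A α)] {J : ∀ α, Ideal (A α)}

/-- **Membership in an ideal of `R'` is local on the finite Away-cover** `(f_α) = R'`: if `x/1 ∈ K·A α` for every `α`
then `x ∈ K`. (Mathlib's `Submodule.mem_of_span_eq_top_of_smul_pow_mem` + `f_α^n x ∈ K` from the local membership.)
[folklore] -/
theorem mem_of_forall_algebraMap_mem_map (hf : Ideal.span (Set.range f) = ⊤) (K : Ideal R') {x : R'}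
    (hx : ∀ α, algebraMap R' (A α) x ∈ K.map (algebraMap R' (A α))) : x ∈ K := by
  refine Submodule.mem_of_span_eq_top_of_smul_pow_mem K (Set.range f) hf x ?_
  rintro ⟨_, α, rfl⟩
  have h := hx α
  rw [IsLocalization.algebraMap_mem_map_algebraMap_iff (Submonoid.powers (f α))] at h
  obtain ⟨m, hm, hmx⟩ := h
  obtain ⟨n, rfl⟩ := (Submonoid.mem_powers_iff _ _).1 hm
  exact ⟨n, by rw [smul_eq_mul]; exact hmx⟩

/-- **Restricted families are compatible**: for any ideal `K ⊆ R'`, the family `(K·A α)_α` satisfies the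
compatibility condition (`x/1 ∈ K·A α ⇒ f_α^m x ∈ K ⇒ f_α^m x/1 ∈ K·A β`). [folklore] -/
theorem compatible_map (K : Ideal R') (α β : ι) (x : R') (hx : algebraMap R' (A α) x ∈ K.map (algebraMap R' (A α))) :
    ∃ m : ℕ, algebraMap R' (A β) (f α ^ m * x) ∈ K.map (algebraMap R' (A β)) := by
  rw [IsLocalization.algebraMap_mem_map_algebraMap_iff (Submonoid.powers (f α))] at hx
  obtain ⟨t, ht, htx⟩ := hx
  obtain ⟨m, rfl⟩ := (Submonoid.mem_powers_iff _ _).1 ht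
  exact ⟨m, Ideal.mem_map_of_mem _ htx⟩

variable [Fintype ι]

omit [∀ α, IsLocalization.Away (f α) (A α)] in
/-- **Key lemma**: for a COMPATIBLE family (`x/1 ∈ J α ⇒ f_α^m x/1 ∈ J β`), `x/1 ∈ J α` implies `f_α^N x ∈ glued A J`
for some `N` (take `N = max_β m_β` over the finite cover). [folklore] -/
theorem exists_pow_mul_mem_glued
    (hc : ∀ α β (x : R'), algebraMap R' (A α) x ∈ J α → ∃ m : ℕ, algebraMap R' (A β) (f α ^ m * x) ∈ J β)
    {α : ι} {x : R'} (hx : algebraMap R' (A α) x ∈ J α) : ∃ N : ℕ, f α ^ N * x ∈ glued A J := by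
  classical
  choose m hm using fun β ↦ hc α β x hx
  refine ⟨Finset.univ.sup m, mem_glued_iff.2 fun β ↦ ?_⟩
  obtain ⟨d, hd⟩ := Nat.exists_eq_add_of_le (Finset.le_sup (f := m) (Finset.mem_univ β))
  rw [hd, pow_add, mul_comm (f α ^ m β) (f α ^ d), mul_assoc, map_mul]
  exact Ideal.mul_mem_left _ _ (hm β)

/-- **The glued ideal restricts to the local ideals**: for a compatible family, `(glued A J)·A α = J α`.
(`⊆` by definition; `⊇`: `y = x/f_α^k ∈ J α` has `x/1 ∈ J α`, so `f_α^N x ∈ glued A J` and `y = f_α^N x / f_α^{N+k}`.)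
[cite: Hartshorne2010, §2 Thm. 2.4 («compatible with localization»)] -/
theorem map_glued_eq
    (hc : ∀ α β (x : R'), algebraMap R' (A α) x ∈ J α → ∃ m : ℕ, algebraMap R' (A β) (f α ^ m * x) ∈ J β)
    (α : ι) : (glued A J).map (algebraMap R' (A α)) = J α := by
  apply le_antisymm
  · rw [Ideal.map_le_iff_le_comap]
    intro x hx
    exact mem_glued_iff.1 hx α
  · intro y hy
    obtain ⟨x, s, rfl⟩ := IsLocalization.exists_mk'_eq (Submonoid.powers (f α)) y
    have hx1 : algebraMap R' (A α) x ∈ J α := by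
      rw [← IsLocalization.mk'_spec (A α) x s]
      exact Ideal.mul_mem_right _ _ hy
    obtain ⟨N, hN⟩ := exists_pow_mul_mem_glued f hc hx1
    rw [IsLocalization.mk'_mem_map_algebraMap_iff (Submonoid.powers (f α))]
    exact ⟨f α ^ N, Submonoid.pow_mem _ (Submonoid.mem_powers _) N, hN⟩

omit [Fintype ι] in
/-- **Uniqueness of the gluing**: an ideal of `R'` restricting to `J α` on every member of the cover IS the glued
ideal. [folklore] -/
theorem eq_glued_of_forall_map_eq (hf : Ideal.span (Set.range f) = ⊤) {K : Ideal R'}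
    (hK : ∀ α, K.map (algebraMap R' (A α)) = J α) : K = glued A J := by
  apply le_antisymm
  · intro x hx
    exact mem_glued_iff.2 fun α ↦ (hK α) ▸ Ideal.mem_map_of_mem _ hx
  · intro x hx
    exact mem_of_forall_algebraMap_mem_map f hf K fun α ↦ (hK α).symm ▸ mem_glued_iff.1 hx α

/-- **`J + eR'` is determined locally**: if for every `α` there is `u ∈ A α` with `w/1 - (e/1)u ∈ J α`, then
`w ∈ glued A J + eR'` (clear the denominator of `u`, apply the key lemma to `f_α^a w - e u₀`, and
`f_α^{N+a} w = f_α^N (f_α^a w - e u₀) + e f_α^N u₀`). [folklore] -/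
theorem mem_glued_sup_span_of_forall (hf : Ideal.span (Set.range f) = ⊤) (e : R')
    (hc : ∀ α β (x : R'), algebraMap R' (A α) x ∈ J α → ∃ m : ℕ, algebraMap R' (A β) (f α ^ m * x) ∈ J β)
    {w : R'} (hw : ∀ α, ∃ u : A α, algebraMap R' (A α) w - algebraMap R' (A α) e * u ∈ J α) :
    w ∈ glued A J ⊔ Ideal.span {e} := by
  refine Submodule.mem_of_span_eq_top_of_smul_pow_mem _ (Set.range f) hf w ?_
  rintro ⟨_, α, rfl⟩
  obtain ⟨u, hu⟩ := hw α
  obtain ⟨u₀, s, rfl⟩ := IsLocalization.exists_mk'_eq (Submonoid.powers (f α)) u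
  obtain ⟨a, ha⟩ := (Submonoid.mem_powers_iff _ _).1 s.2
  have h1 : algebraMap R' (A α) (f α ^ a * w - e * u₀) ∈ J α := by
    have h2 := Ideal.mul_mem_left (J α) (algebraMap R' (A α) (s : R')) hu
    rw [mul_sub, ← map_mul, mul_left_comm, IsLocalization.mk'_spec', ← map_mul, ← map_sub, ← ha] at h2
    exact h2
  obtain ⟨N, hN⟩ := exists_pow_mul_mem_glued f hc h1
  refine ⟨N + a, ?_⟩
  have e1 : ((f α ^ (N + a) : R') : R') • w = f α ^ N * (f α ^ a * w - e * u₀) + (f α ^ N * u₀) * e := by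
    rw [smul_eq_mul]; ring
  rw [e1]
  exact Ideal.add_mem _ (Ideal.mem_sup_left hN)
    (Ideal.mem_sup_right (Ideal.mul_mem_left _ _ (Ideal.mem_span_singleton_self e)))

end Glue

/-! ### Gluing flat lifts -/

section GlueLift

variable {R' : Type u} {R : Type v} [CommRing R'] [CommRing R] {π : R' →+* R} {e : R'}
variable {ι : Type w} (f : ι → R')
variable (A : ι → Type u') [∀ α, CommRing (A α)] [∀ α, Algebra R' (A α)] [∀ α, IsLocalization.Away (f α) (A α)]
variable (B : ι → Type v') [∀ α, CommRing (B α)] [∀ α, Algebra R (B α)]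
  [∀ α, IsLocalization ((Submonoid.powers (f α)).map π) (B α)]

/-- The cover `(π f_α)` of `R` generates the unit ideal (image of `(f_α) = R'`). [folklore] -/
theorem span_range_map_eq_top (π : R' →+* R) (hf : Ideal.span (Set.range f) = ⊤) :
    Ideal.span (Set.range fun α ↦ π (f α)) = ⊤ := by
  have h := congrArg (Ideal.map π) hf
  rw [Ideal.map_span, Ideal.map_top, ← Set.range_comp] at h
  exact h

variable [Fintype ι]

/-- **GLUING FLAT LIFTS (Hartshorne Thm. 2.4 / 6.2 (a) made global on an affine): a compatible family of flat lifts
`J α` of `I·B α` to the localised thickenings `πₐ : A α ↠ B α` (parameter `e/1`) on a finite Away-cover `(f_α) = R'`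
glues to a flat lift of `I` to `π`** — namely `glued A J`, which restricts to `J α` on each `Spec A α`
(`map_glued_eq`) and is the only such ideal (`eq_glued_of_forall_map_eq`); conversely `IsLift.eq_glued_map`.
[cite: Hartshorne2010, §6 Thm. 6.2 (a)] -/
theorem isLift_glued (hT : IsFirstOrderThickening π e) (hf : Ideal.span (Set.range f) = ⊤) {I : Ideal R}
    {J : ∀ α, Ideal (A α)}
    (hJ : ∀ α, IsLift (locMap π (Submonoid.powers (f α)) (A α) (B α)) (algebraMap R' (A α) e)
      (I.map (algebraMap R (B α))) (J α))
    (hc : ∀ α β (x : R'), algebraMap R' (A α) x ∈ J α → ∃ m : ℕ, algebraMap R' (A β) (f α ^ m * x) ∈ J β) :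
    IsLift π e I (glued A J) where
  map_mem z hz := by
    refine Submodule.mem_of_span_eq_top_of_smul_pow_mem I _ (span_range_map_eq_top f π hf) (π z) ?_
    rintro ⟨_, α, rfl⟩
    have h1 := (hJ α).map_mem _ (mem_glued_iff.1 hz α)
    rw [locMap_algebraMap, IsLocalization.algebraMap_mem_map_algebraMap_iff ((Submonoid.powers (f α)).map π),
      Submonoid.map_powers] at h1
    obtain ⟨m, hm, hmz⟩ := h1
    obtain ⟨n, rfl⟩ := (Submonoid.mem_powers_iff _ _).1 hm
    exact ⟨n, by rw [smul_eq_mul]; exact hmz⟩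
  exists_mem x hx := by
    obtain ⟨w, hw⟩ := hT.surjective x
    have hK : w ∈ glued A J ⊔ Ideal.span {e} := by
      refine mem_glued_sup_span_of_forall f hf e hc fun α ↦ ?_
      obtain ⟨z, hz, hzx⟩ := (hJ α).exists_mem (algebraMap R (B α) x) (Ideal.mem_map_of_mem _ hx)
      have h0 : locMap π (Submonoid.powers (f α)) (A α) (B α) (algebraMap R' (A α) w - z) = 0 := by
        rw [map_sub, locMap_algebraMap, hw, hzx, sub_self]
      obtain ⟨u, hu⟩ := ((hT.localization (Submonoid.powers (f α)) (A α) (B α)).ker_iff _).1 h0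
      exact ⟨u, by rw [← hu, sub_sub_cancel]; exact hz⟩
    obtain ⟨j, hj, u, hu, rfl⟩ := Submodule.mem_sup.1 hK
    obtain ⟨c, rfl⟩ := Ideal.mem_span_singleton'.1 hu
    refine ⟨j, hj, ?_⟩
    rw [map_add, map_mul, hT.map_eps, mul_zero, add_zero] at hw
    exact hw
  eps_flat z hz := by
    have hK : z ∈ glued A J ⊔ Ideal.span {e} := by
      refine mem_glued_sup_span_of_forall f hf e hc fun α ↦ ?_
      have h1 : algebraMap R' (A α) e * algebraMap R' (A α) z ∈ J α := by
        rw [← map_mul]; exact mem_glued_iff.1 hz α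
      exact (hJ α).eps_flat _ h1
    obtain ⟨j, hj, u, hu, rfl⟩ := Submodule.mem_sup.1 hK
    obtain ⟨c, rfl⟩ := Ideal.mem_span_singleton'.1 hu
    exact ⟨c, by rw [show j + c * e - e * c = j by ring]; exact hj⟩

omit [Fintype ι] in
/-- **Conversely, a global flat lift restricts to a compatible family of flat lifts** whose gluing gives it back:
flat lifts of `I` to `π` ⟷ compatible families of flat lifts on the cover. [cite: Hartshorne2010, §6 Thm. 6.2 (a)] -/
theorem IsLift.eq_glued_map (hf : Ideal.span (Set.range f) = ⊤) {I : Ideal R} {K : Ideal R'} (hK : IsLift π e I K) :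
    (∀ α, IsLift (locMap π (Submonoid.powers (f α)) (A α) (B α)) (algebraMap R' (A α) e)
        (I.map (algebraMap R (B α))) (K.map (algebraMap R' (A α)))) ∧
      K = glued A (fun α ↦ K.map (algebraMap R' (A α))) :=
  ⟨fun α ↦ hK.localization (Submonoid.powers (f α)) (A α) (B α), eq_glued_of_forall_map_eq f hf fun _ ↦ rfl⟩

/-- **THE SHEAF PROPERTY AS A BIJECTION**: flat lifts of `I` to `π` `≃` compatible families of flat lifts of the
`I·B α` to the localised thickenings `πₐ` on the finite Away-cover — `K ↦ (K·A α)_α`, inverse `J ↦ glued A J`.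
[cite: Hartshorne2010, §6 Thm. 6.2 (a)] -/
def liftEquivCompatibleFamily (hT : IsFirstOrderThickening π e) (hf : Ideal.span (Set.range f) = ⊤) (I : Ideal R) :
    {K : Ideal R' // IsLift π e I K} ≃
      {J : ∀ α, Ideal (A α) //
        (∀ α, IsLift (locMap π (Submonoid.powers (f α)) (A α) (B α)) (algebraMap R' (A α) e)
            (I.map (algebraMap R (B α))) (J α)) ∧
          ∀ α β (x : R'), algebraMap R' (A α) x ∈ J α → ∃ m : ℕ, algebraMap R' (A β) (f α ^ m * x) ∈ J β} where
  toFun K := ⟨fun α ↦ K.1.map (algebraMap R' (A α)),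
    fun α ↦ K.2.localization (Submonoid.powers (f α)) (A α) (B α), compatible_map f K.1⟩
  invFun J := ⟨glued A J.1, isLift_glued f A B hT hf J.2.1 J.2.2⟩
  left_inv _ := Subtype.ext (eq_glued_of_forall_map_eq f hf (fun _ ↦ rfl)).symm
  right_inv J := Subtype.ext (funext fun α ↦ map_glued_eq f J.2.2 α)

/-! ### The criterion behind the Čech sentence: a global flat lift exists iff some translates of the local
TRIVIAL lifts (local sections `σ_α` of `πₐ` = local triviality of the thickening) form a compatible family -/

/-- **CRITERION (Prop. K's Čech sentence in torsor form).**  Let the thickening be locally split: ring sections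
`σ_α : B α → A α` of `πₐ` (`A_ξ|_{U_α} ≅ U_α[ε]`).  Then a flat lift of `I` to `π` EXISTS iff there are normal vectors
`φ_α ∈ Hom(I·B α, B α/I·B α)` such that the translates `(σ_α-lift) + φ_α` of the local trivial lifts (Torsor file:
`translate`, `isLift_map_section`) form a COMPATIBLE family — (⇐) glue them (`isLift_glued`); (⇒) a global lift `K`
restricts to `K·A α = (σ_α-lift) + φ_α` with `φ_α := diff(σ_α-lift, K·A α)` (`translate_diff`), a compatible family
(`compatible_map`).  Rewriting «compatible» as «`φ_β|_{αβ} - φ_α|_{αβ} = diff(σ_α-lift, σ_β-lift)|_{αβ} = π(θ_αβ)`» is the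
Čech-notation form (overlaps; not typed here). [cite: Hartshorne2010, §6 Thm. 6.2 (a)] -/
theorem exists_isLift_iff_exists_compatible_translate (hT : IsFirstOrderThickening π e)
    (hf : Ideal.span (Set.range f) = ⊤) (I : Ideal R) (σ : ∀ α, B α →+* A α)
    (hσ : ∀ α (b : B α), locMap π (Submonoid.powers (f α)) (A α) (B α) (σ α b) = b) :
    (∃ K : Ideal R', IsLift π e I K) ↔
      ∃ φ : ∀ α, I.map (algebraMap R (B α)) →ₗ[B α] B α ⧸ I.map (algebraMap R (B α)),
        ∀ α β (x : R'),
          algebraMap R' (A α) x ∈ translate (locMap π (Submonoid.powers (f α)) (A α) (B α)) (algebraMap R' (A α) e)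
              ((I.map (algebraMap R (B α))).map (σ α)) (I.map (algebraMap R (B α))) (φ α) →
            ∃ m : ℕ, algebraMap R' (A β) (f α ^ m * x) ∈
              translate (locMap π (Submonoid.powers (f β)) (A β) (B β)) (algebraMap R' (A β) e)
                ((I.map (algebraMap R (B β))).map (σ β)) (I.map (algebraMap R (B β))) (φ β) := by
  -- the localised thickenings and the local trivial lifts
  have hTl : ∀ α, IsFirstOrderThickening (locMap π (Submonoid.powers (f α)) (A α) (B α)) (algebraMap R' (A α) e) :=
    fun α ↦ hT.localization (Submonoid.powers (f α)) (A α) (B α)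
  have h0 : ∀ α, IsLift (locMap π (Submonoid.powers (f α)) (A α) (B α)) (algebraMap R' (A α) e)
      (I.map (algebraMap R (B α))) ((I.map (algebraMap R (B α))).map (σ α)) :=
    fun α ↦ isLift_map_section (hTl α) (σ α) (hσ α) _
  constructor
  · rintro ⟨K, hK⟩
    have hKl := fun α ↦ hK.localization (Submonoid.powers (f α)) (A α) (B α)
    refine ⟨fun α ↦ (h0 α).diff (hTl α) (hKl α), fun α β x hx ↦ ?_⟩
    rw [translate_diff (hTl α) (h0 α) (hKl α)] at hx
    rw [translate_diff (hTl β) (h0 β) (hKl β)]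
    exact compatible_map f K α β x hx
  · rintro ⟨φ, hc⟩
    exact ⟨glued A _, isLift_glued f A B hT hf (fun α ↦ isLift_translate (hTl α) (h0 α) (φ α)) hc⟩

end GlueLift

end EmbeddedDeformation

end Summit.Ventures.HSemireg
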